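import Summits.ResolutionOfSingularities.ResolutionOfSingularities.Theorems.WildQuotientsGaloisQuotientEtale
import Literature.AlgebraicGeometry.RelativeSpec.FiniteGroupQuotientGluing
import HarnessLib

/-!
# The glued quotient `X′ → X′/G` by a faithful finite group is generically étale

Route `ResolutionOfSingularities/WildQuotients`, support items `GaloisReduction`
(stmt-ResolutionOfSingularities-15641) and `GaloisQuotientAlteration`
(stmt-ResolutionOfSingularities-16323). Companion of `…Theorems.WildQuotientsGaloisQuotientEtale`
(`exists_dense_etale_morphismRestrict`: a finite GEOMETRIC quotient of an integral separated
scheme by a faithful finite group is étale over a dense open), transported to the tree's GLUED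
quotient `ActionOver.glued` / `gluedMk` of `Literature.AlgebraicGeometry.RelativeSpec.FiniteGroupQuotientGluing`
(Mumford, *Abelian Varieties*, §7, Thm. p. 66; SGA 1, V, Prop. 1.8) — the quotient the route's
provers form from de Jong's quasi-projective Galois alteration
(`Literature.AlgebraicGeometry.Resolution.DeJong1997_galoisAlterationQuasiProjective`):

* `of_isPullback_morphismRestrict_image` — a target-local property of `p₀ ∣_ U₀` for a chart
  `p₀ : O → V` of `m : X → Q` (a cartesian square over an open immersion `V ↪ Q`) passes to
  `m ∣_ j(U₀)`;
* `injective_restrict_aut` — a faithful action on an integral separated scheme stays faithful on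
  every non-empty stable open;
* `exists_dense_etale_gluedMk_morphismRestrict` — **`gluedMk : X′ → X′/G` is étale over a dense
  open** when `X′` is integral and `G` acts faithfully.
-/

-- single-problem summit: the doubled namespace component `ResolutionOfSingularities` is forced
set_option linter.dupNamespace false

noncomputable section

open CategoryTheory Limits AlgebraicGeometry

namespace Summit.ResolutionOfSingularities.ResolutionOfSingularities.Theorems

open Literature.AlgebraicGeometry.RelativeSpec

universe u

/-! ### Transport of target-local properties along a chart -/

/-- For a cartesian square `p₀ ≫ j = i ≫ m` with `i`, `j` open immersions, the preimage under `m`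
of `j(U₀)` is `i(p₀⁻¹ U₀)`. [folklore] -/
theorem preimage_image_eq_of_isPullback {O X V Q : Scheme.{u}} {p₀ : O ⟶ V} {i : O ⟶ X}
    {j : V ⟶ Q} {m : X ⟶ Q} [IsOpenImmersion j] (hsq : IsPullback p₀ i j m) (U₀ : V.Opens) :
    ((m ⁻¹ᵁ (j ''ᵁ U₀) : X.Opens) : Set X) = i '' (p₀ ⁻¹ᵁ U₀ : Set O) := by
  ext x
  constructor
  · rintro ⟨v, hv, hjv⟩
    obtain ⟨z, hz1, hz2⟩ := Scheme.Pullback.exists_preimage_pullback (f := j) (g := m) v x hjv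
    refine ⟨hsq.isoPullback.inv z, ?_, ?_⟩
    · change p₀ (hsq.isoPullback.inv z) ∈ U₀
      rw [← Scheme.Hom.comp_apply, IsPullback.isoPullback_inv_fst, hz1]
      exact hv
    · rw [← Scheme.Hom.comp_apply, IsPullback.isoPullback_inv_snd, hz2]
  · rintro ⟨o, ho, rfl⟩
    refine ⟨p₀ o, ho, ?_⟩
    change (p₀ ≫ j) o = (i ≫ m) o
    rw [hsq.w]

/-- **Transport of a target-local property along a chart.** Let `p₀ ≫ j = i ≫ m` be a cartesian
square of schemes with `i : O ↪ X` and `j : V ↪ Q` open immersions (so `p₀` is `m` restricted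
over the open `j(V)`), `P` a property of morphisms local on the target, and `U₀ ⊆ V` open. If
`P (p₀ ∣_ U₀)` then `P (m ∣_ j(U₀))`: the two are isomorphic over the isomorphism
`U₀ ≅ j(U₀)`. [folklore] -/
theorem of_isPullback_morphismRestrict_image {P : MorphismProperty Scheme.{u}}
    [IsZariskiLocalAtTarget P] {O X V Q : Scheme.{u}} {p₀ : O ⟶ V} {i : O ⟶ X} {j : V ⟶ Q}
    {m : X ⟶ Q} [IsOpenImmersion i] [IsOpenImmersion j] (hsq : IsPullback p₀ i j m)
    (U₀ : V.Opens) (hP : P (p₀ ∣_ U₀)) : P (m ∣_ (j ''ᵁ U₀)) := by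
  set U : Q.Opens := j ''ᵁ U₀ with hU
  -- the isomorphism of the targets `U₀ ≅ U` over `Q`
  have hrU : Set.range (U₀.ι ≫ j) = Set.range U.ι := by
    rw [Scheme.Hom.comp_base, TopCat.coe_comp, Set.range_comp, Scheme.Opens.range_ι,
      Scheme.Opens.range_ι]
    rfl
  let eU : (U₀ : Scheme.{u}) ≅ U := IsOpenImmersion.isoOfRangeEq (U₀.ι ≫ j) U.ι hrU
  have heU : eU.hom ≫ U.ι = U₀.ι ≫ j := IsOpenImmersion.isoOfRangeEq_hom_fac _ _ _
  -- the isomorphism of the sources `m⁻¹U ≅ p₀⁻¹U₀` over `X`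
  have hrX : Set.range (m ⁻¹ᵁ U).ι = Set.range ((p₀ ⁻¹ᵁ U₀).ι ≫ i) := by
    rw [Scheme.Opens.range_ι, Scheme.Hom.comp_base, TopCat.coe_comp, Set.range_comp,
      Scheme.Opens.range_ι, hU]
    exact preimage_image_eq_of_isPullback hsq U₀
  let eX : ((m ⁻¹ᵁ U : X.Opens) : Scheme.{u}) ≅ (p₀ ⁻¹ᵁ U₀ : O.Opens) :=
    IsOpenImmersion.isoOfRangeEq (m ⁻¹ᵁ U).ι ((p₀ ⁻¹ᵁ U₀).ι ≫ i) hrX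
  have heX : eX.hom ≫ (p₀ ⁻¹ᵁ U₀).ι ≫ i = (m ⁻¹ᵁ U).ι := IsOpenImmersion.isoOfRangeEq_hom_fac _ _ _
  -- the square `eX ≫ (p₀ ∣_ U₀) = (m ∣_ U) ≫ eU⁻¹` commutes (check after the mono `U₀ ↪ V ↪ Q`)
  have hcomm : eX.hom ≫ (p₀ ∣_ U₀) = (m ∣_ U) ≫ eU.inv := by
    haveI : Mono (U₀.ι ≫ j) := mono_comp _ _
    rw [← cancel_mono (U₀.ι ≫ j)]
    have h1 : eX.hom ≫ (p₀ ∣_ U₀) ≫ U₀.ι ≫ j = (m ⁻¹ᵁ U).ι ≫ m := by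
      rw [morphismRestrict_ι_assoc, hsq.w, ← heX]
      simp only [Category.assoc]
    have h2 : ((m ∣_ U) ≫ eU.inv) ≫ U₀.ι ≫ j = (m ⁻¹ᵁ U).ι ≫ m := by
      rw [← heU]
      simp only [Category.assoc, Iso.inv_hom_id_assoc, morphismRestrict_ι]
    rw [Category.assoc, h1, h2]
  exact IsZariskiLocalAtTarget.of_isPullback (IsPullback.of_horiz_isIso ⟨hcomm⟩) hP

/-! ### Faithfulness on stable opens -/

section Restrict

variable {X' X : Scheme.{u}} {π : X' ⟶ X} {G : Type u} [Group G] (ρ : ActionOver π G)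

/-- **A faithful action stays faithful on every non-empty stable open** of an integral separated
scheme: if `g` restricts to the identity of the dense open `O` then `g` agrees with `𝟙` on `O`,
hence everywhere (`X′` reduced, separated). [folklore] -/
theorem injective_restrict_aut [IsIntegral X'] [X'.IsSeparated] (hinj : Function.Injective ρ.aut)
    (O : X'.Opens) (hO : ∀ g : G, (ρ.aut g).hom ⁻¹ᵁ O = O) (hne : (O : Set X').Nonempty) :
    Function.Injective (ρ.restrict O hO).aut := by
  intro g g' hgg'
  -- reduce to `g' = 1`
  rw [← inv_mul_eq_one]
  apply hinj
  rw [map_one]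
  have h1 : (ρ.restrict O hO).aut (g⁻¹ * g') = 1 := by rw [map_mul, map_inv, hgg', inv_mul_cancel]
  set k := g⁻¹ * g' with hk
  have hres : ρ.restrictHom O hO k = 𝟙 _ := by
    rw [← ActionOver.restrict_aut_hom, h1]
    rfl
  have hι : O.ι ≫ (ρ.aut k).hom = O.ι ≫ 𝟙 X' := by
    rw [← ρ.restrictHom_ι O hO k, hres, Category.id_comp, Category.comp_id]
  haveI : IsDominant O.ι := ⟨by rw [DenseRange, Scheme.Opens.range_ι]; exact O.2.dense hne⟩
  have hk1 : (ρ.aut k).hom = 𝟙 X' := ext_of_isDominant O.ι hι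
  ext : 1
  exact hk1

end Restrict

/-! ### The glued quotient is generically étale -/

section Glued

variable {X' X : Scheme.{u}} {π : X' ⟶ X} {G : Type u} [Group G] (ρ : ActionOver π G)
variable [Finite G] [X.IsSeparated] [IsSeparated π]

/-- **The glued quotient map `X′ → X′/G` of an integral scheme by a faithful finite group is étale
over a dense open of `X′/G`** (SGA 1, Exp. V, Prop. 2.6 / Cor. 2.4 at the generic point; for the
tree's `ActionOver.gluedMk`, Mumford AV §7 Thm. p. 66): on a non-empty chart `O` (a `G`-stable
open affine over `X`), `O → O/G` is a finite geometric quotient of the integral separated `O` by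
the restricted — still faithful, `injective_restrict_aut` — action, hence étale over a dense open
`U₀ ⊆ O/G` (`exists_dense_etale_morphismRestrict`); transport along the chart `O/G ↪ X′/G`
(`isPullback_chart`, `of_isPullback_morphismRestrict_image`), and `U₀ ↪ X′/G` is dense because
`X′/G` is irreducible. [cite: SGA1, Exp. V, Prop. 2.6] [cite: MumfordAV1970, §7 Thm. p. 66] -/
theorem exists_dense_etale_gluedMk_morphismRestrict [IsIntegral X']
    (hcov : ∀ x : X', ∃ O : ρ.StableAffineOpens, x ∈ O.1) (hinj : Function.Injective ρ.aut) :
    ∃ U : (ρ.glued).Opens, Dense (U : Set ρ.glued) ∧ Etale (ρ.gluedMk hcov ∣_ U) := by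
  -- `X′` is separated (over the separated `X`)
  haveI : X'.IsSeparated := ⟨by rw [← terminal.comp_from π]; infer_instance⟩
  -- a non-empty chart
  obtain ⟨x'⟩ := (inferInstance : Nonempty X')
  obtain ⟨O, hxO⟩ := hcov x'
  have hne : (O.1 : Set X').Nonempty := ⟨x', hxO⟩
  haveI : Nonempty (O.1 : Scheme.{u}) := ⟨⟨x', hxO⟩⟩
  haveI : IsIntegral (O.1 : Scheme.{u}) := isIntegral_of_isOpenImmersion O.1.ι
  haveI : (O.1 : Scheme.{u}).IsSeparated := ActionOver.isSeparated_opens O.1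
  -- the piece `O → O/G` is a finite geometric quotient by a faithful action: generically étale
  let ρO := ρ.restrict O.1 O.2.1
  have hgeo : ρO.IsGeometricQuotient ρO.toQuotient := ρO.isGeometricQuotient_toQuotient
  have hinjO : Function.Injective ρO.aut := injective_restrict_aut ρ hinj O.1 O.2.1 hne
  obtain ⟨U₀, hU₀, hU₀et⟩ := exists_dense_etale_morphismRestrict ρO hgeo hinjO
  -- transport along the chart `O/G ↪ X′/G`
  refine ⟨ρ.gluedι O ''ᵁ U₀, ?_, of_isPullback_morphismRestrict_image (P := @Etale)
    (ρ.isPullback_chart hcov O) U₀ hU₀et⟩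
  -- density: `X′/G` is irreducible and `U₀` is non-empty
  haveI : PreirreducibleSpace ρ.glued := by
    refine ⟨?_⟩
    have himg : (ρ.gluedMk hcov : X' → ρ.glued) '' Set.univ = Set.univ :=
      Set.image_univ_of_surjective (ρ.gluedMk_surjective hcov)
    rw [← himg]
    exact (PreirreducibleSpace.isPreirreducible_univ (X := X')).image _
      (ρ.gluedMk hcov).continuous.continuousOn
  refine (ρ.gluedι O ''ᵁ U₀).2.dense ?_
  haveI : Nonempty (ρ.pieceQuot O) := ⟨ρ.pieceMk O ⟨x', hxO⟩⟩
  obtain ⟨v, hv⟩ := hU₀.nonempty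
  exact ⟨ρ.gluedι O v, v, hv, rfl⟩

end Glued

end Summit.ResolutionOfSingularities.ResolutionOfSingularities.Theorems

end
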